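import Mathlib
import Summits.Ventures.HodgeRepro.Tier4.Line1.RTFSetting
import Summits.Ventures.HodgeRepro.Tier4.Line1.InnerCalculus
import Summits.Ventures.HodgeRepro.Tier4.Line1.HeckeFiniteness
import Summits.Ventures.HodgeRepro.Tier4.Line1.HeckeFinitenessType
import Summits.Ventures.HodgeRepro.Tier4.Line1.LevelBlockFinite
import Summits.Ventures.HodgeRepro.Tier4.Line1.HeckeIsolation
import Summits.Ventures.HodgeRepro.Tier4.Line1.HeckeRankOneOfBlock
import Summits.Ventures.HodgeRepro.Tier4.Line1.HeckeBlockWeak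

/-!
# Tier4/Line1/HeckeBlockSpherical — the SPHERICAL instance of the Hecke block: the level average `R(1_K / μ K)` as the
idempotent, its four identities DISCHARGED in the kernel for a compact open `K` (module 4b of the self-pointed cut
S13690 / S13715 / S13738 / S13823; plan-1's call S13828 (a))

Blind re-derivation cell `pub-hodge-repro`, Tier 4 (README §9–§10), seat t4-L1-p5 (prover, LINE L1, gen 3).  Target tree
path `lean/Summits/Ventures/HodgeRepro/Tier4/Line1/HeckeBlockSpherical.lean`.  Imports this seat's `HeckeBlockWeak`
(`HeckeBlockW`, its `exists_isolatedAt_hecke`), t4-L1-p1 g3's `LevelBlockFinite` (p684555: `levelBlock`,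
`finiteDimensional_levelBlock` — fact (A) as a theorem), `HeckeFiniteness` (`R_mul_right_of_left_invariant`), t4-L1-p4's
`InnerCalculus` (`inner_R_eq_inner_R_adj`, the adjoint identity of `R(f)` on `L²(D_G)`).

WHAT THIS IS.  `HeckeBlockW` (module 4a) displays a finite Hecke block with a level idempotent `e` satisfying four
identities.  For a COMPACT OPEN subgroup `K ≤ G` the tree can supply all four from the setting's own integrals:
* the block: `sphericalBlock S K` = the `Gk`-invariant right-`K`-invariant functions (a ℂ-subspace of `G → ℂ`),
  FINITE-DIMENSIONAL by p1's (A) (`sphericalBlock_le_levelBlock`, `finiteDimensional_sphericalBlock`), and its members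
  are CONTINUOUS (locally constant on the open cosets `xK`: `continuous_of_mem_sphericalBlock`);
* the idempotent: `indK S K = (μ K)⁻¹ · 1_K` is a test function (`K` clopen and compact: `isTest_indK`), left-`K`-invariant
  and symmetric (`cj (refl indK) = indK`); `e := S.R (indK S K)` is the level average;
* its identities: `he_mem` — `e ψ` lies in every invariant subspace containing `ψ` (`IsInvariantSubspace.conv`) and in
  the block (right-`K`-invariance by `R_mul_right_of_left_invariant`); `he_id` — the average of a right-`K`-invariant
  function is itself (`R_indK_of_right_invariant`); `he_R` — `R(f)(e ψ) = R(f) ψ` for a right-`K`-invariant test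
  function `f` and continuous `ψ` (`R_R_indK`: Fubini on `μ.prod μ`, the substitution `g ↦ g h⁻¹` by the right
  invariance of the Haar measure, and `∫ indK = 1`); `he_adj` — `e` is self-adjoint for `S.inner` on continuous
  invariant functions (`inner_R_indK_adj`: p4's adjoint identity with `cj (refl indK) = indK`).
* `HeckeBlockW.spherical`: the `HeckeBlockW` on `sphericalBlock S K` with these four fields DISCHARGED; what stays
  DISPLAYED are the `H`-module structure of the block (`hact` — the convolution law), the isotypic projections `π`,
  (C1) simplicity and (C2) pairwise non-isomorphism of the constituents; `exists_isolatedAt_spherical` = (S3a) with the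
  isolating pair in the Hecke algebra, from exactly those.
HONEST SCOPE (plan-1 S13828 / F-L1-ARCH S13820; crit-2 S13587 / p1 S13616 for the same caveat on (S1b)): on the
instance `K` is OPEN in the full adelic group `U(W)(𝔸)`, so it contains the identity component of the archimedean
factor — the spherical block is the TRIVIAL archimedean type, and it has content only on a TOTALLY definite plane
(`IsTotallyDefinite`, the line's displayed clause), weight-0 test pairs; the corner forms' type `σ` needs the
`σ`-isotypic projector (a class function of `K_∞`, not a character) and p1's `levelBlock S K e` with `e` = the matrix
coefficients of `σ` — for that block the four identities stay DISPLAYED (module 4a's fields).  This module shows that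
`HeckeBlockW` is instantiable and that fact (A) and the idempotent identities are kernel facts in the spherical case;
nothing of (C1), (C2) or the convolution law is proved, and nothing here moves (P).  Nothing here says anything about
the status of the Hodge conjecture for CM abelian varieties, which is NOT proved (HC_CM is NOT proved by anyone in
this repository).
-/

set_option autoImplicit false

noncomputable section

namespace Summit.Ventures.HodgeRepro.Tier4.Line1

open MeasureTheory Topology Set
open scoped Pointwise

namespace RTF.Setting

variable {G : Type} [Group G] [TopologicalSpace G] [IsTopologicalGroup G] [MeasurableSpace G] [BorelSpace G]
  (S : Setting G) (K : Subgroup G)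

section Block

/-- **the spherical block of level `K`**: the `Gk`-invariant, right-`K`-invariant functions, as a ℂ-subspace. -/
def sphericalBlock : Submodule ℂ (G → ℂ) where
  carrier := {ψ | S.Invariant ψ ∧ ∀ x, ∀ k ∈ K, ψ (x * k) = ψ x}
  add_mem' := by
    intro a b ha hb
    refine ⟨fun γ x => ?_, fun x k hk => ?_⟩
    · simp only [Pi.add_apply]
      rw [ha.1 γ x, hb.1 γ x]
    · simp only [Pi.add_apply]
      rw [ha.2 x k hk, hb.2 x k hk]
  zero_mem' := ⟨fun _ _ => rfl, fun _ _ _ => rfl⟩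
  smul_mem' := by
    intro c a ha
    refine ⟨fun γ x => ?_, fun x k hk => ?_⟩
    · simp only [Pi.smul_apply]
      rw [ha.1 γ x]
    · simp only [Pi.smul_apply]
      rw [ha.2 x k hk]

omit [IsTopologicalGroup G] [BorelSpace G] in
/-- membership in the spherical block. -/
theorem mem_sphericalBlock {ψ : G → ℂ} :
    ψ ∈ sphericalBlock S K ↔ S.Invariant ψ ∧ ∀ x, ∀ k ∈ K, ψ (x * k) = ψ x := Iff.rfl

omit [IsTopologicalGroup G] [BorelSpace G] in
/-- the spherical block is the level block of the trivial type `e = 1` (p1's `levelBlock`). -/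
theorem sphericalBlock_le_levelBlock : sphericalBlock S K ≤ levelBlock S K (fun (_ : Fin 1) (_ : K) => (1 : ℂ)) := by
  intro ψ hψ
  refine ⟨hψ.1, fun x => ?_⟩
  have h : (fun k : K => ψ (x * k)) = ψ x • fun (_ : K) => (1 : ℂ) := by
    funext k
    simp only [Pi.smul_apply, smul_eq_mul, mul_one]
    exact hψ.2 x k k.2
  rw [h]
  exact Submodule.smul_mem _ _ (Submodule.subset_span ⟨0, rfl⟩)

omit [BorelSpace G] in
/-- **(A) for the spherical block**: finite-dimensional for an open `K` (p1's `finiteDimensional_levelBlock`). -/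
theorem finiteDimensional_sphericalBlock (hK : IsOpen (K : Set G)) : FiniteDimensional ℂ (sphericalBlock S K) := by
  haveI := S.finiteDimensional_levelBlock K (fun (_ : Fin 1) (_ : K) => (1 : ℂ)) hK
  exact Submodule.finiteDimensional_of_le (S.sphericalBlock_le_levelBlock K)

omit [MeasurableSpace G] [BorelSpace G] in
/-- a right-`K`-invariant function is locally constant on the open cosets `x K`, hence continuous, for `K` open. -/
theorem continuous_of_right_invariant (hK : IsOpen (K : Set G)) {ψ : G → ℂ}
    (hψ : ∀ x, ∀ k ∈ K, ψ (x * k) = ψ x) : Continuous ψ := by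
  apply IsLocallyConstant.continuous
  rw [IsLocallyConstant.iff_exists_open]
  intro x
  refine ⟨x • (K : Set G), hK.smul x, ⟨1, K.one_mem, mul_one x⟩, ?_⟩
  intro x' hx'
  obtain ⟨k, hk, rfl⟩ := hx'
  exact hψ x k hk

omit [BorelSpace G] in
/-- the members of the spherical block are continuous (`K` open). -/
theorem continuous_of_mem_sphericalBlock (hK : IsOpen (K : Set G)) {ψ : G → ℂ} (hψ : ψ ∈ sphericalBlock S K) :
    Continuous ψ :=
  continuous_of_right_invariant K hK hψ.2

end Block

section Average

/-- **the normalised indicator of `K`**: `indK = (μ K)⁻¹ · 1_K`, the kernel of the level average. -/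
def indK : G → ℂ := (K : Set G).indicator fun _ => (((S.μ K).toReal⁻¹ : ℝ) : ℂ)

omit [IsTopologicalGroup G] [BorelSpace G] in
/-- `indK` on `K`. -/
theorem indK_of_mem {g : G} (hg : g ∈ K) : indK S K g = (((S.μ K).toReal⁻¹ : ℝ) : ℂ) := by
  simp only [indK, Set.indicator_of_mem (show g ∈ (K : Set G) from hg)]

omit [IsTopologicalGroup G] [BorelSpace G] in
/-- `indK` off `K`. -/
theorem indK_of_not_mem {g : G} (hg : g ∉ K) : indK S K g = 0 := by
  simp only [indK, Set.indicator_of_notMem (show g ∉ (K : Set G) from hg)]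

omit [BorelSpace G] in
/-- `indK` is a test function for a compact open `K` (clopen ⟹ continuous; compact ⟹ compact support). -/
theorem isTest_indK (hKo : IsOpen (K : Set G)) (hKc : IsCompact (K : Set G)) : IsTest (indK S K) := by
  have hcl : IsClopen (K : Set G) := ⟨K.isClosed_of_isOpen hKo, hKo⟩
  exact ⟨hcl.continuous_indicator continuous_const,
    HasCompactSupport.intro hKc fun _ hx => Set.indicator_of_notMem hx _⟩

omit [IsTopologicalGroup G] [BorelSpace G] in
/-- `indK` is left-`K`-invariant. -/
theorem indK_left_invariant : ∀ k ∈ K, ∀ g, indK S K (k * g) = indK S K g := by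
  intro k hk g
  by_cases hg : g ∈ K
  · rw [S.indK_of_mem K (K.mul_mem hk hg), S.indK_of_mem K hg]
  · rw [S.indK_of_not_mem K hg, S.indK_of_not_mem K]
    intro h
    exact hg ((K.mul_mem_cancel_left hk).mp h)

omit [IsTopologicalGroup G] [BorelSpace G] in
/-- `indK` is right-`K`-invariant. -/
theorem indK_right_invariant : ∀ g, ∀ k ∈ K, indK S K (g * k) = indK S K g := by
  intro g k hk
  by_cases hg : g ∈ K
  · rw [S.indK_of_mem K (K.mul_mem hg hk), S.indK_of_mem K hg]
  · rw [S.indK_of_not_mem K hg, S.indK_of_not_mem K]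
    intro h
    exact hg ((K.mul_mem_cancel_right hk).mp h)

omit [IsTopologicalGroup G] [BorelSpace G] in
/-- `indK` is symmetric: `conj (indK g⁻¹) = indK g`. -/
theorem cj_refl_indK : cj (refl (indK S K)) = indK S K := by
  funext g
  simp only [cj, refl]
  by_cases hg : g ∈ K
  · rw [S.indK_of_mem K (K.inv_mem hg), S.indK_of_mem K hg, Complex.conj_ofReal]
  · rw [S.indK_of_not_mem K (fun h => hg (by simpa using K.inv_mem h)), S.indK_of_not_mem K hg, map_zero]

omit [IsTopologicalGroup G] [BorelSpace G] in
/-- the Haar measure of a non-empty open set is non-zero. -/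
theorem measure_ne_zero_of_isOpen (hKo : IsOpen (K : Set G)) : S.μ K ≠ 0 := by
  haveI := S.haar
  exact hKo.measure_ne_zero S.μ ⟨1, K.one_mem⟩

omit [IsTopologicalGroup G] [BorelSpace G] in
/-- the Haar measure of a compact set is finite. -/
theorem measure_ne_top_of_isCompact (hKc : IsCompact (K : Set G)) : S.μ K ≠ ⊤ := by
  haveI := S.haar
  exact hKc.measure_lt_top.ne

omit [IsTopologicalGroup G] [BorelSpace G] in
/-- the normalisation: `(μ K) · (μ K)⁻¹ = 1` in `ℂ`. -/
theorem measure_mul_inv_eq_one (hKo : IsOpen (K : Set G)) (hKc : IsCompact (K : Set G)) :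
    (((S.μ K).toReal : ℝ) : ℂ) * (((S.μ K).toReal⁻¹ : ℝ) : ℂ) = 1 := by
  have h : (S.μ K).toReal ≠ 0 :=
    ENNReal.toReal_ne_zero.mpr ⟨S.measure_ne_zero_of_isOpen K hKo, S.measure_ne_top_of_isCompact K hKc⟩
  rw [← Complex.ofReal_mul, mul_inv_cancel₀ h, Complex.ofReal_one]

omit [IsTopologicalGroup G] in
/-- **the level average of a right-`K`-invariant function is itself**: `R(indK) v = v`. -/
theorem R_indK_of_right_invariant (hKo : IsOpen (K : Set G)) (hKc : IsCompact (K : Set G)) {v : G → ℂ}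
    (hv : ∀ x, ∀ k ∈ K, v (x * k) = v x) : S.R (indK S K) v = v := by
  funext x
  unfold R
  have h : (fun g => indK S K g * v (x * g)) =
      (K : Set G).indicator fun _ => (((S.μ K).toReal⁻¹ : ℝ) : ℂ) * v x := by
    funext g
    by_cases hg : g ∈ K
    · rw [S.indK_of_mem K hg, hv x g hg, Set.indicator_of_mem (show g ∈ (K : Set G) from hg)]
    · rw [S.indK_of_not_mem K hg, zero_mul, Set.indicator_of_notMem (show g ∉ (K : Set G) from hg)]
  rw [h, integral_indicator hKo.measurableSet, setIntegral_const, Complex.real_smul, Measure.real, ← mul_assoc,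
    S.measure_mul_inv_eq_one K hKo hKc, one_mul]

omit [IsTopologicalGroup G] in
/-- `∫ indK = 1`. -/
theorem integral_indK (hKo : IsOpen (K : Set G)) (hKc : IsCompact (K : Set G)) :
    ∫ g, indK S K g ∂S.μ = 1 := by
  unfold indK
  rw [integral_indicator hKo.measurableSet, setIntegral_const, Complex.real_smul, Measure.real,
    S.measure_mul_inv_eq_one K hKo hKc]

/-- the integrand of the Fubini step is integrable on `μ.prod μ` (continuous, support in `tsupport f ×ˢ K`). -/
theorem integrable_prod_indK [SecondCountableTopology G] (hKo : IsOpen (K : Set G)) (hKc : IsCompact (K : Set G))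
    {f ψ : G → ℂ} (hf : IsTest f) (hψ : Continuous ψ) (x : G) :
    Integrable (Function.uncurry fun (g h : G) => f g * (indK S K h * ψ (x * g * h))) (S.μ.prod S.μ) := by
  haveI := S.haar
  have hind := S.isTest_indK K hKo hKc
  apply Continuous.integrable_of_hasCompactSupport
  · apply Continuous.mul
    · exact hf.cont.comp continuous_fst
    · apply Continuous.mul
      · exact hind.cont.comp continuous_snd
      · exact hψ.comp ((continuous_const.mul continuous_fst).mul continuous_snd)
  · apply HasCompactSupport.intro (hf.compact.isCompact.prod hKc)
    intro p hp
    show f p.1 * (indK S K p.2 * ψ (x * p.1 * p.2)) = 0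
    by_cases h1 : p.1 ∈ tsupport f
    · have h2 : p.2 ∉ (K : Set G) := fun h => hp ⟨h1, h⟩
      rw [S.indK_of_not_mem K h2, zero_mul, mul_zero]
    · rw [image_eq_zero_of_notMem_tsupport h1, zero_mul]

/-- **the level average is invisible to right-`K`-invariant test functions**: `R(f)(R(indK) ψ) = R(f) ψ` for a
right-`K`-invariant test function `f` and continuous `ψ` — Fubini on `μ.prod μ`, the substitution `g ↦ g h⁻¹` (right
invariance of the Haar measure) and `∫ indK = 1`. -/
theorem R_R_indK [SecondCountableTopology G] [MeasurableMul G] [SFinite S.μ] (hKo : IsOpen (K : Set G))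
    (hKc : IsCompact (K : Set G)) {f ψ : G → ℂ} (hf : IsTest f) (hfK : ∀ y, ∀ k ∈ K, f (y * k) = f y) (hψ : Continuous ψ) :
    S.R f (S.R (indK S K) ψ) = S.R f ψ := by
  haveI := S.haar
  haveI := S.rightInv
  funext x
  have hint := S.integrable_prod_indK K hKo hKc hf hψ x
  -- the inner `G`-integral for a fixed `h`
  have hinner : ∀ h : G, ∫ g, f g * (indK S K h * ψ (x * g * h)) ∂S.μ = indK S K h * S.R f ψ x := by
    intro h
    have e0 : (fun g => f g * (indK S K h * ψ (x * g * h))) = fun g => indK S K h * (f g * ψ (x * g * h)) := by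
      funext g
      ring
    rw [e0, integral_const_mul]
    by_cases hh : h ∈ K
    · congr 1
      have hsub : ∫ g, f (g * h * h⁻¹) * ψ (x * (g * h)) ∂S.μ = ∫ g, f (g * h⁻¹) * ψ (x * g) ∂S.μ :=
        integral_mul_right_eq_self (fun g => f (g * h⁻¹) * ψ (x * g)) h
      have e1 : (fun g => f g * ψ (x * g * h)) = fun g => f (g * h * h⁻¹) * ψ (x * (g * h)) := by
        funext g
        rw [mul_inv_cancel_right, mul_assoc]
      have e2 : (fun g => f (g * h⁻¹) * ψ (x * g)) = fun g => f g * ψ (x * g) := by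
        funext g
        rw [hfK g h⁻¹ (K.inv_mem hh)]
      rw [e1, hsub, e2]
      rfl
    · rw [S.indK_of_not_mem K hh, zero_mul, zero_mul]
  calc S.R f (S.R (indK S K) ψ) x
      = ∫ g, ∫ h, f g * (indK S K h * ψ (x * g * h)) ∂S.μ ∂S.μ := by
        unfold R
        congr 1
        funext g
        rw [integral_const_mul]
    _ = ∫ h, ∫ g, f g * (indK S K h * ψ (x * g * h)) ∂S.μ ∂S.μ := integral_integral_swap hint
    _ = ∫ h, indK S K h * S.R f ψ x ∂S.μ := by
        congr 1
        funext h
        exact hinner h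
    _ = S.R f ψ x := by
        rw [integral_mul_const, S.integral_indK K hKo hKc, one_mul]

/-- **the level average is self-adjoint** for `S.inner` on continuous invariant functions (p4's adjoint identity with
`cj (refl indK) = indK`). -/
theorem inner_R_indK_adj [SecondCountableTopology G] (hKo : IsOpen (K : Set G)) (hKc : IsCompact (K : Set G))
    {ψ v : G → ℂ} (hψ : S.Invariant ψ) (hψc : Continuous ψ) (hv : S.Invariant v) (hvc : Continuous v) :
    S.inner (S.R (indK S K) ψ) v = S.inner ψ (S.R (indK S K) v) := by
  rw [S.inner_R_eq_inner_R_adj (S.isTest_indK K hKo hKc) hψ hψc hv hvc, S.cj_refl_indK K]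

end Average

section Instance

variable {S K}

/-- **THE SPHERICAL HECKE BLOCK**: for a compact open `K`, a `HeckeBlockW` on `sphericalBlock S K` with the idempotent
`e := R(indK)` and its four identities DISCHARGED; the `H`-module structure of the block (`hact`), the projections `π`,
(C1) and (C2) stay DISPLAYED (they are the arguments). -/
def HeckeBlockW.spherical (τ : ℕ → Set (G → ℂ)) (m : ℕ) (hKo : IsOpen (K : Set G)) (hKc : IsCompact (K : Set G))
    [SecondCountableTopology G] [MeasurableMul G] [SFinite S.μ] (hinv : ∀ m', S.IsInvariantSubspace (τ m'))
    (H : Type) [Ring H] [Algebra ℂ H] (ι : Type) [Fintype ι] [DecidableEq ι]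
    [FiniteDimensional ℂ (sphericalBlock S K)] [Module H (sphericalBlock S K)]
    [IsScalarTower ℂ H (sphericalBlock S K)]
    (tst : H → (G → ℂ)) (htst : ∀ r, IsTest (tst r)) (htstK : ∀ r y, ∀ k ∈ K, tst r (y * k) = tst r y)
    (hact : ∀ (r : H) (ψ : sphericalBlock S K), ((r • ψ : sphericalBlock S K) : G → ℂ) = S.R (tst r) ψ)
    (idx : ι → ℕ) (i₀ : ι) (hi₀ : idx i₀ = m) (W : ι → Submodule H (sphericalBlock S K))
    (hW : ∀ (i : ι) (ψ : sphericalBlock S K), ψ ∈ W i ↔ (ψ : G → ℂ) ∈ τ (idx i))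
    (π : ι → sphericalBlock S K →ₗ[H] sphericalBlock S K) (hπmem : ∀ i v, π i v ∈ W i)
    (hπsum : ∀ v, ∑ i, π i v = v) (hπid : ∀ i, ∀ w ∈ W i, π i w = w)
    (hπzero : ∀ i j, i ≠ j → ∀ w ∈ W j, π i w = 0) [simple : ∀ i, IsSimpleModule H (W i)]
    (hnon : ∀ i j, i ≠ j → IsEmpty ((W i) ≃ₗ[H] (W j))) :
    HeckeBlockW S τ m H ι (sphericalBlock S K) where
  tst := tst
  htst := htst
  hact := hact
  idx := idx
  i₀ := i₀
  hi₀ := hi₀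
  W := W
  hW := hW
  π := π
  hπmem := hπmem
  hπsum := hπsum
  hπid := hπid
  hπzero := hπzero
  simple := simple
  hnon := hnon
  e := S.R (indK S K)
  he_mem := fun m' ψ hψ =>
    have hconv : S.R (indK S K) ψ ∈ τ m' := (hinv m').conv ψ hψ _ (S.isTest_indK K hKo hKc)
    ⟨⟨(hinv m').inv _ hconv, fun x _ hk => S.R_mul_right_of_left_invariant K (S.indK_left_invariant K) ψ hk x⟩,
      hconv⟩
  he_R := fun r m' ψ hψ => (S.R_R_indK K hKo hKc (htst r) (htstK r) ((hinv m').cont ψ hψ)).symm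
  he_adj := fun m' ψ hψ _ hv =>
    S.inner_R_indK_adj K hKo hKc ((hinv m').inv ψ hψ) ((hinv m').cont ψ hψ) hv.1
      (continuous_of_mem_sphericalBlock S K hKo hv)
  he_id := fun _ hv => S.R_indK_of_right_invariant K hKo hKc hv.2

/-- **(S3a) ON THE SPHERICAL BLOCK**: for a compact open `K`, from the displayed `H`-module structure, projections, (C1),
(C2) and the two toric periods on the spherical admissible vectors, a pair of Hecke elements isolates `τ m`. -/
theorem exists_isolatedAt_spherical [Countable S.Gk] [MeasurableMul G] [SecondCountableTopology G] [SFinite S.μ]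
    {χ : S.T → ℂ} {χ' : S.T' → ℂ} {τ : ℕ → Set (G → ℂ)} {φ : ℕ → G → ℂ} {n : ℕ → ℕ}
    (hB : S.IsAdaptedONB τ φ n) {m : ℕ} (hKo : IsOpen (K : Set G)) (hKc : IsCompact (K : Set G))
    (H : Type) [Ring H] [Algebra ℂ H] (ι : Type) [Fintype ι] [DecidableEq ι]
    [Module H (sphericalBlock S K)] [IsScalarTower ℂ H (sphericalBlock S K)]
    (tst : H → (G → ℂ)) (htst : ∀ r, IsTest (tst r)) (htstK : ∀ r y, ∀ k ∈ K, tst r (y * k) = tst r y)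
    (hact : ∀ (r : H) (ψ : sphericalBlock S K), ((r • ψ : sphericalBlock S K) : G → ℂ) = S.R (tst r) ψ)
    (idx : ι → ℕ) (i₀ : ι) (hi₀ : idx i₀ = m) (W : ι → Submodule H (sphericalBlock S K))
    (hW : ∀ (i : ι) (ψ : sphericalBlock S K), ψ ∈ W i ↔ (ψ : G → ℂ) ∈ τ (idx i))
    (π : ι → sphericalBlock S K →ₗ[H] sphericalBlock S K) (hπmem : ∀ i v, π i v ∈ W i)
    (hπsum : ∀ v, ∑ i, π i v = v) (hπid : ∀ i, ∀ w ∈ W i, π i w = w)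
    (hπzero : ∀ i j, i ≠ j → ∀ w ∈ W j, π i w = 0) [∀ i, IsSimpleModule H (W i)]
    (hnon : ∀ i j, i ≠ j → IsEmpty ((W i) ≃ₗ[H] (W j)))
    (hT : ∃ w ∈ blockAdmissible τ m (sphericalBlock S K), S.periodT χ (fun t => w t) ≠ 0)
    (hT' : ∃ w' ∈ blockAdmissible τ m (sphericalBlock S K), S.periodT' χ' (fun t' => w' t') ≠ 0) :
    ∃ r r' : H, IsolatedAt S χ χ' φ n (cj (tst r)) (refl (tst r')) m := by
  haveI := S.finiteDimensional_sphericalBlock K hKo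
  exact (HeckeBlockW.spherical τ m hKo hKc hB.inv H ι tst htst htstK hact idx i₀ hi₀ W hW π hπmem hπsum hπid
    hπzero hnon).exists_isolatedAt_hecke hB hT hT'

end Instance

end RTF.Setting

end Summit.Ventures.HodgeRepro.Tier4.Line1

end
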